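import Literature.Barriers.CriticalPhenomena.LaceExpansionIsingAboveFour
import Literature.Probability.LatticeModels.GriffithsMonotonicity
import Literature.Probability.LatticeModels.LebowitzInequality
import Literature.Probability.LatticeModels.GKSInequalities
import Literature.Probability.LatticeModels.IsingTransport
import Literature.Probability.LatticeModels.PlusStateFKG
import Literature.Probability.LatticeModels.MeanFieldBoundGHS
import HarnessLib

/-!
# Bubble condition ⇒ `γ = 1` for the spread-out Ising model: decomposition and proofs

Barrier catalogue `Literature/Barriers/CriticalPhenomena/` (D-0021), sibling proof file of
`LaceExpansionIsingAboveFour.lean`, working towards the discharge of the named fact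
`Literature.Barriers.CriticalPhenomena.SpreadOutIsing.IsingBubbleMeanField`
(`∀ d L, 2 ≤ d → 1 ≤ L → BubbleCondition d L → HasGammaOne d L`: for the uniformly spread-out
Ising model on `ℤ^d`, finiteness of the bubble diagram at `β_c` forces `χ_β ≍ (β_c - β)⁻¹`),
i.e. of the sentence of Sakai 2007, §1.1: "the finiteness of `Σ_{x∈ℤ^d} G_{p_c}(x)²` … implies
that `β = 1/2`, `γ = 1` and `δ = 3` [a82, abf87, af86, ag83]" (exponent `γ`).

## The printed architecture (Aizenman 1982; Aizenman–Barsky–Fernández 1987; as summarised by Duminil-Copin 2022, §7.1)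

For `h = 0` and `β < β_c` the susceptibility `χ(β) = Σ_x ⟨σ₀σ_x⟩_β` of the nearest-neighbour
model obeys the differential inequalities
`(1 - B/χ)·2dχ²/(1+B) ≤ ∂_β χ ≤ 2dχ²`, `B(β) = Σ_x ⟨σ₀σ_x⟩²_β` the bubble diagram
(Duminil-Copin 2022, §7.1, p. 22); "Since … `B(β)` remains bounded uniformly in `β < β_c` …,
`χ(β)` must blow up like `1/|β - β_c|`". The upper inequality is Lebowitz' `U₄ ≤ 0` inserted in
`∂_β ⟨σ₀σ_x⟩ = Σ_{uv} J_{uv}(⟨σ₀σ_xσ_uσ_v⟩ - ⟨σ₀σ_x⟩⟨σ_uσ_v⟩)` and gives the mean-field bound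
`γ ≥ 1` ("These exponents (if they exist) are known to obey the mean-field bounds: `β ≤ 1/2`,
`γ ≥ 1` and `δ ≥ 3`", Sakai 2007, §1.1) once one knows that `χ_β ↑ ∞` as `β ↑ β_c` ("The
susceptibility `χ_p` is known to diverge as `p ↑ p_c` [a82, ag83]", ibid.); the lower
inequality is Aizenman's random-current bound and gives `γ ≤ 1` under the bubble condition. Both
use that `0 < β_c < ∞` ("When `d ≥ 2`, there exists a unique critical inverse temperature
`p_c ∈ (0,∞)` such that … `χ_p` is finite if `p < p_c`, while … `χ_p = ∞` if `p > p_c`", ibid.).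

## The decomposition (named facts of this file, all about the objects of the barrier file:
`spreadOutTwoPoint`, `spreadOutSusceptibility`, `critBeta`, `bubbleDiagram`)

1. `exists_pos_susceptibility_lt_top` — `χ_β < ∞` for some `β > 0` (high temperature);
2. `exists_forall_le_susceptibility_eq_top` — `d ≥ 2`, `L ≥ 1`: `χ_β = ∞` for all large `β`
   (low temperature; makes `critBeta d L = sup {β ≥ 0 : χ_β < ∞}` a genuine supremum);
3. `inv_susceptibility_sub_le` — `χ_{β₁}⁻¹ - χ_{β₂}⁻¹ ≤ |J|(β₂ - β₁)` for `0 ≤ β₁ ≤ β₂`,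
   `χ_{β₂} < ∞` (integrated `∂_βχ ≤ |J|χ²`, `|J|` = number of neighbours of `0`);
4. `susceptibility_unbounded_below_critBeta` — `χ` is unbounded on `[0, β_c)`;
5. `bubble_susceptibility_upper` — `B(β_c) < ∞ ⟹ χ_β ≤ C(β_c - β)⁻¹` near `β_c` (Aizenman).

PROVED here: `IsingBubbleMeanField_of_facts : (1) → (2) → (3) → (4) → (5) → IsingBubbleMeanField`
(with the lower constant `c = (|J|+1)⁻¹`), through `toReal_susceptibility_inv_le`
(`χ_β⁻¹ ≤ |J|(β_c - β)` on `[0, β_c)` from (3)–(4)), and the elementary theory of the monotone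
limit `G_β(x) = sup_n ⟨σ₀σ_x⟩^∅_{Λ_n;β,0}` from the tree's GKS inequalities on an arbitrary
locally finite graph (`GKSInequalities`, `GriffithsMonotonicity`): junk value `0` outside the
box, `0 ≤ ⟨σ₀σ_x⟩_{Λ_n} ≤ 1`, monotonicity in the volume and in `β ≥ 0`, continuity in `β`,
`⟨σ₀σ_x⟩_{Λ_n;β} ↑ G_β(x)`, left lower semicontinuity, `1 ≤ χ_β`, monotonicity of `χ`, and the
order properties of `critBeta` (`χ < ∞` below, `= ∞` above, `0 < β_c`) given (1)–(2).
PROVED here, fact (3): `inv_susceptibility_sub_le_holds` (so `IsingBubbleMeanField_of_facts'`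
needs only (1), (2), (4), (5)), along the printed route — Step A: Lebowitz' inequality in the
sharp pair form `⟨σ_aσ_zσ_xσ_y⟩ - ⟨σ_aσ_z⟩⟨σ_xσ_y⟩ ≤ ⟨σ_aσ_x⟩⟨σ_yσ_z⟩ + ⟨σ_aσ_y⟩⟨σ_xσ_z⟩` at
zero field (`isingExpect_cov_spinPair_le`, from `lebowitz_pair` of `LebowitzInequality`: at
`h = 0` the one-spin sums vanish and the Glimm–Jaffe factor `2` disappears); Step B:
`∂_β⟨σ_aσ_x⟩_Λ ≤ Σ_{u∈Λ}Σ_{v∼u}⟨σ_aσ_u⟩_Λ⟨σ_xσ_v⟩_Λ` (`deriv_isingTwoPoint_free_le`, any locally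
finite graph) and the mean-value increment bound (`isingTwoPoint_free_sub_le`); Step C:
translation invariance of the spread-out graph, `⟨σ_xσ_v⟩_{Λ_n} ≤ G(v - x)`, the increment bound
`G_{β₂}(x) ≤ G_{β₁}(x) + (β₂-β₁)Σ_uΣ_{v∼u}G_{β₂}(u)G_{β₂}(v-x)` in `[0,∞]` and, summing over `x`
(Tonelli, `Σ_x G(v-x) = χ`, `|J|` neighbours), `χ_{β₂} ≤ χ_{β₁} + (β₂-β₁)|J|χ_{β₂}²`
(`susceptibility_le_add_mul_sq`); Step D: the partition argument turning this one-sided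
increment bound for the nondecreasing `χ ≥ 1` into `χ_{β₁}⁻¹ - χ_{β₂}⁻¹ ≤ |J|(β₂-β₁)`
(`inv_sub_inv_le_of_increment`), with no differentiability of the infinite-volume `χ`.
Facts (1), (2), (4) are classical and provable from the tree's finite-volume machinery (the
boundary inequalities of `LebowitzInequality`/`ModifiedSimonInequality`, Peierls); fact (5) is
the residual content of Aizenman 1982 / Aizenman–Graham 1983, whose texts are not held (cited
through Sakai's statement and Duminil-Copin's survey).

## Design choices

* Integrated (difference) forms instead of differential inequalities: no differentiability of
  the infinite-volume `χ_β` is asserted; the named facts quantify over `0 ≤ β₁ ≤ β₂` with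
  `χ_{β₂} < ∞`, which by monotonicity is the regime `β₂ < β_c` (or `= β_c` if finite there).
* `|J| = Σ_x J_{0,x}` is rendered as `(spreadOutGraph d L).degree 0` (coupling `1` on the
  `(2L+1)^d - 1` neighbours; Sakai's normalisation `1/N_L` is absorbed in `β`, as in the barrier
  file), matching Duminil-Copin's `2d` for the nearest-neighbour graph.
* Fact (5) is stated as the conclusion printed by Sakai (upper half of `χ_p ≍ (p_c - p)⁻¹`), not
  as Duminil-Copin's differential inequality, whose constants for general finite-range `J` are
  not printed in a held source.
* Nothing in `LaceExpansionIsingAboveFour.lean` is restated or modified.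

## Status (audit 2026-08-15, second pass)

All five named facts are now theorems of the tree — (1), (2), (4):
`exists_pos_susceptibility_lt_top_holds`, `exists_forall_le_susceptibility_eq_top_holds`,
`susceptibility_unbounded_below_critBeta_holds` (`LaceExpansionIsingAboveFourReduction.lean`); (3):
`inv_susceptibility_sub_le_holds` (this file); (5): `bubble_susceptibility_upper_holds`
(`LaceExpansionIsingAboveFourSODischarge.lean`, from the random-current proof of the Aizenman–Graham
inequality) — and the target is the unconditional `SpreadOutIsing.IsingBubbleMeanField_holds`; the
phrases "Named fact, not proved here" below describe the state at the time of writing. The audit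
records are `LaceExpansionIsingAboveFourProofsAudit.lean` (kernel-level confirmation; Sakai's Theorem
1.3 feeds the decomposition for `d ≥ 5`; the `d = 2` slice of the target is vacuous for every `L ≥ 1`,
`SpreadOutIsing.not_bubbleCondition_two`; at `d = 3` the hypothesis `BubbleCondition 3 L` is open). Two
Friedli–Velenik locators were corrected in this pass: monotonicity in `β` is Exercise 3.9 (not 3.13),
and the spin-flip identity is the solution of Exercise 3.16 (not eq. (3.33)).

## References

* A. Sakai, *Lace expansion for the Ising model*, Comm. Math. Phys. 272 (2007) 283–344,
  arXiv:math-ph/0510093, §1.1 (p. 3 of the arXiv version) [Sakai2007].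
* H. Duminil-Copin, *100 years of the (critical) Ising model on the hypercubic lattice*,
  ICM 2022, arXiv:2208.00864, §7.1 (p. 22) [DuminilCopinICM2022].
* M. Aizenman, *Geometric analysis of φ⁴ fields and Ising models I, II*, Comm. Math. Phys. 86
  (1982) 1–48 [Aizenman1982] (not held; cited through Sakai 2007 and Duminil-Copin 2022).
* M. Aizenman, R. Graham, Nucl. Phys. B 225 (1983) 261–288 [AizenmanGraham1983] (not held).
* M. Aizenman, D. Barsky, R. Fernández, J. Stat. Phys. 47 (1987) 343–374, Thm. 1
  [AizenmanBarskyFernandezJSP1987].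
* S. Friedli, Y. Velenik, *Statistical Mechanics of Lattice Systems*, CUP 2017, Thm. 3.20,
  Exercises 3.9, 3.12 and 3.16 (solution, p. 566), §3.7.3 eq. (3.49), Exercise 3.24 [FriedliVelenik2017].
* J. Glimm, A. Jaffe, *Quantum Physics*, 2nd ed. (1987), Thm. 17.7.1 and its proof (p. 277:
  `0 ≤ dχ⁻¹/dσ ≤ 1`, §17.4) [GlimmJaffe1987]. R. Peierls, Proc. Camb. Phil. Soc. 32 (1936) 477 [Peierls1936].
-/

noncomputable section

namespace Literature.Barriers.CriticalPhenomena.SpreadOutIsing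

open MeasureTheory Filter Topology Finset Literature.Probability.LatticeModels Literature.Probability.Percolation
open scoped ENNReal BigOperators symmDiff

variable {d L : ℕ}

/-! ### Finite-volume two-point functions of the spread-out model: elementary bounds -/

/-- GKS II for every locally finite graph on `ℤ^d`, in the form consumed by the volume
monotonicity lemma of `GriffithsMonotonicity`. [cite: FriedliVelenik2017, Thm. 3.20, eq. (3.22), p. 109] -/
theorem gks_two_all (G' : SimpleGraph (Site d)) [G'.LocallyFinite] (Λ A B : Finset (Site d))
    (β h : ℝ) (bc : BoundaryCondition (Site d)) :
    Literature.Probability.LatticeModels.gks_two G' (Λ := Λ) (A := A) (B := B) (β := β) (h := h) (bc := bc) :=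
  Literature.Probability.LatticeModels.GKSInequalities.gks_two_holds G'

/-- `⟨σ₀σ₀⟩ = 1`. [folklore] -/
@[simp] theorem boxTwoPoint_zero_right (β : ℝ) (n : ℕ) : boxTwoPoint d L β n 0 = 1 := by
  simp [boxTwoPoint]

/-- `|⟨σ₀σ_x⟩_{Λ_n}| ≤ 1`. [cite: FriedliVelenik2017, §3.6.1] -/
theorem abs_boxTwoPoint_le_one (β : ℝ) (n : ℕ) (x : Site d) : |boxTwoPoint d L β n x| ≤ 1 :=
  abs_isingTwoPoint_le_one _ _ _ _ _ _ _

/-- `⟨σ₀σ_x⟩_{Λ_n} ≤ 1`. [cite: FriedliVelenik2017, §3.6.1] -/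
theorem boxTwoPoint_le_one (β : ℝ) (n : ℕ) (x : Site d) : boxTwoPoint d L β n x ≤ 1 :=
  (le_abs_self _).trans (abs_boxTwoPoint_le_one β n x)

/-- Outside the box the observable `σ₀σ_x` reduces, on the support of the free measure (outside
spins frozen to the junk value `1`), to `σ₀`, whose zero-field free average vanishes by the spin
flip: `⟨σ₀σ_x⟩^∅_{Λ_n;β,0} = ⟨σ₀⟩^∅_{Λ_n;β,0} = 0` for `x ∉ Λ_n` (a junk value of the definition,
recorded to make volume monotonicity unconditional). [cite: FriedliVelenik2017, Exercise 3.16 (solution, p. 566: spin-flip identity)] -/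
theorem boxTwoPoint_of_not_mem (β : ℝ) {n : ℕ} {x : Site d} (hx : x ∉ box d n) :
    boxTwoPoint d L β n x = 0 := by
  have h0 : (0 : Site d) ∈ box d n := zero_mem_box d n
  have key : isingTwoPoint (spreadOutGraph d L) (box d n) β 0 .free 0 x =
      isingCorr (spreadOutGraph d L) (box d n) β 0 .free {0} := by
    rw [isingTwoPoint, isingCorr, isingExpect, isingExpect,
      integral_isingMeasure _ _ _ _ _ (measurable_spinPair _ _),
      integral_isingMeasure _ _ _ _ _ (measurable_spinProduct _)]
    congr 1
    refine Finset.sum_congr rfl fun τ _ => ?_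
    congr 1
    simp only [spinPair, spinProduct, Finset.prod_singleton]
    rw [spinAt_glue_of_not_mem τ _ hx]
    simp [BoundaryCondition.outside, spinAt]
  rw [boxTwoPoint, key, isingCorr_free_singleton_zero_field _ _ _ h0]

/-- `⟨σ₀σ_x⟩_{Λ_n} = ⟨σ_{{0,x}}⟩_{Λ_n}` for `x ≠ 0`. [folklore] -/
theorem boxTwoPoint_eq_isingCorr (β : ℝ) (n : ℕ) {x : Site d} (hx : x ≠ 0) :
    boxTwoPoint d L β n x = isingCorr (spreadOutGraph d L) (box d n) β 0 .free {0, x} := by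
  rw [boxTwoPoint, isingTwoPoint_eq_isingCorr _ _ _ _ _ (Ne.symm hx)]

/-- `⟨σ₀σ_x⟩^∅_{Λ_n;β,0} ≥ 0` for `β ≥ 0` (GKS I; the junk value outside the box is `0`).
[cite: FriedliVelenik2017, Thm. 3.20, eq. (3.21), p. 109] -/
theorem boxTwoPoint_nonneg {β : ℝ} (hβ : 0 ≤ β) (n : ℕ) (x : Site d) :
    0 ≤ boxTwoPoint d L β n x := by
  by_cases hxn : x ∈ box d n
  · by_cases hx : x = 0
    · subst hx; simp
    · rw [boxTwoPoint_eq_isingCorr β n hx]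
      refine Literature.Probability.LatticeModels.GKSInequalities.gks_one_holds (spreadOutGraph d L) hβ le_rfl (Or.inl rfl) ?_
      intro y hy
      rcases Finset.mem_insert.1 hy with rfl | hy
      · exact zero_mem_box d n
      · rw [Finset.mem_singleton.1 hy]; exact hxn
  · rw [boxTwoPoint_of_not_mem β hxn]

/-- **Volume monotonicity** of the finite-volume free two-point functions of the spread-out model
along the centred boxes, `β ≥ 0` (GKS II; Friedli–Velenik 2017, Exercise 3.12).
[cite: FriedliVelenik2017, Exercise 3.12] -/
theorem boxTwoPoint_mono_volume {β : ℝ} (hβ : 0 ≤ β) (x : Site d) :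
    Monotone fun n => boxTwoPoint d L β n x := by
  refine monotone_nat_of_le_succ fun n => ?_
  by_cases hxn : x ∈ box d n
  · by_cases hx : x = 0
    · subst hx; simp
    · simp only [boxTwoPoint_eq_isingCorr β _ hx]
      refine isingCorr_free_le_of_subset (spreadOutGraph d L) hβ le_rfl ?_
        (box_mono d (Nat.le_succ n))
      intro y hy
      rcases Finset.mem_insert.1 hy with rfl | hy
      · exact zero_mem_box d n
      · rw [Finset.mem_singleton.1 hy]; exact hxn
  · show boxTwoPoint d L β n x ≤ boxTwoPoint d L β (n + 1) x
    rw [boxTwoPoint_of_not_mem β hxn]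
    exact boxTwoPoint_nonneg hβ _ _

/-- **Monotonicity in `β`** of the finite-volume free two-point functions on `[0, ∞)` (GKS II;
Friedli–Velenik 2017, Exercise 3.9: `⟨σ_A⟩` is increasing in the couplings). [cite: FriedliVelenik2017, Exercise 3.9] -/
theorem boxTwoPoint_mono_beta (n : ℕ) (x : Site d) :
    MonotoneOn (fun β => boxTwoPoint d L β n x) (Set.Ici 0) := by
  intro β hβ β' hβ' hle
  by_cases hxn : x ∈ box d n
  · by_cases hx : x = 0
    · subst hx; simp
    · simp only [boxTwoPoint_eq_isingCorr _ _ hx]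
      refine Literature.Probability.LatticeModels.monotoneOn_isingCorr_free (spreadOutGraph d L)
        (fun Λ A B β h bc => Literature.Probability.LatticeModels.GKSInequalities.gks_two_holds _) le_rfl ?_ hβ hβ' hle
      intro y hy
      rcases Finset.mem_insert.1 hy with rfl | hy
      · exact zero_mem_box d n
      · rw [Finset.mem_singleton.1 hy]; exact hxn
  · simp only [boxTwoPoint_of_not_mem _ hxn, le_refl]

/-- `β ↦ ⟨σ₀σ_x⟩_{Λ_n;β}` is continuous (finite Boltzmann sums). [folklore] -/
theorem continuous_boxTwoPoint (n : ℕ) (x : Site d) :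
    Continuous fun β => boxTwoPoint d L β n x :=
  continuous_isingExpect (spreadOutGraph d L) (box d n) 0 .free (measurable_spinPair 0 x)

/-! ### The infinite-volume two-point function `G_β(x) = sup_n ⟨σ₀σ_x⟩_{Λ_n;β}` -/

/-- The defining family is bounded above (by `1`). [folklore] -/
theorem bddAbove_range_boxTwoPoint (β : ℝ) (x : Site d) :
    BddAbove (Set.range fun n => boxTwoPoint d L β n x) :=
  ⟨1, by rintro _ ⟨n, rfl⟩; exact boxTwoPoint_le_one β n x⟩

/-- `⟨σ₀σ_x⟩_{Λ_n;β} ≤ G_β(x)`. [cite: Sakai2007, §1.1 (monotone infinite-volume limit)] -/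
theorem boxTwoPoint_le_spreadOutTwoPoint (β : ℝ) (n : ℕ) (x : Site d) :
    boxTwoPoint d L β n x ≤ spreadOutTwoPoint d L β x :=
  le_ciSup (bddAbove_range_boxTwoPoint β x) n

/-- `G_β(x) ≤ 1`. [folklore] -/
theorem spreadOutTwoPoint_le_one (β : ℝ) (x : Site d) : spreadOutTwoPoint d L β x ≤ 1 :=
  ciSup_le fun n => boxTwoPoint_le_one β n x

/-- `G_β(0) = 1`. [folklore] -/
@[simp] theorem spreadOutTwoPoint_zero_right (β : ℝ) : spreadOutTwoPoint d L β 0 = 1 := by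
  simp [spreadOutTwoPoint]

/-- `G_β(x) ≥ 0` for `β ≥ 0`. [cite: FriedliVelenik2017, Thm. 3.20, eq. (3.21), p. 109] -/
theorem spreadOutTwoPoint_nonneg {β : ℝ} (hβ : 0 ≤ β) (x : Site d) :
    0 ≤ spreadOutTwoPoint d L β x :=
  (boxTwoPoint_nonneg hβ 0 x).trans (boxTwoPoint_le_spreadOutTwoPoint β 0 x)

/-- **The monotone infinite-volume limit**: for `β ≥ 0`, `⟨σ₀σ_x⟩_{Λ_n;β} ↑ G_β(x)` as `n → ∞`
("there exist monotone infinite-volume limits", Sakai 2007, §1.1). [cite: Sakai2007, §1.1] -/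
theorem tendsto_boxTwoPoint {β : ℝ} (hβ : 0 ≤ β) (x : Site d) :
    Tendsto (fun n => boxTwoPoint d L β n x) atTop (𝓝 (spreadOutTwoPoint d L β x)) :=
  tendsto_atTop_ciSup (boxTwoPoint_mono_volume hβ x) (bddAbove_range_boxTwoPoint β x)

/-- **`G_β(x)` is nondecreasing in `β ≥ 0`** (GKS II). [cite: FriedliVelenik2017, Exercise 3.9] -/
theorem spreadOutTwoPoint_mono_beta (x : Site d) :
    MonotoneOn (fun β => spreadOutTwoPoint d L β x) (Set.Ici 0) := by
  intro β hβ β' hβ' hle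
  refine ciSup_le fun n => ?_
  exact (boxTwoPoint_mono_beta n x hβ hβ' hle).trans (boxTwoPoint_le_spreadOutTwoPoint β' n x)

/-- **Left lower semicontinuity in `β`**: `G_β(x) = sup_{0 ≤ β' < β} G_{β'}(x)` in the form
"`G_β(x) ≤ c` as soon as `G_{β'}(x) ≤ c` for all `0 ≤ β' < β`" (`β > 0`): the supremum over `n`
of the continuous nondecreasing functions `β ↦ ⟨σ₀σ_x⟩_{Λ_n;β}` (the semicontinuity argument of
Aizenman–Duminil-Copin–Sidoravicius 2015, §3.3). [cite: AizenmanDuminilCopinSidoraviciusCMP2015, §3.3] -/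
theorem spreadOutTwoPoint_le_of_forall_lt {x : Site d} {β c : ℝ} (hβ : 0 < β)
    (h : ∀ β' : ℝ, 0 ≤ β' → β' < β → spreadOutTwoPoint d L β' x ≤ c) :
    spreadOutTwoPoint d L β x ≤ c := by
  refine ciSup_le fun n => ?_
  -- `⟨σ₀σ_x⟩_{Λ_n;β} = lim_{β' ↑ β} ⟨σ₀σ_x⟩_{Λ_n;β'} ≤ c`
  have hcont : Tendsto (fun β' => boxTwoPoint d L β' n x) (𝓝[<] β) (𝓝 (boxTwoPoint d L β n x)) :=
    ((continuous_boxTwoPoint n x).tendsto β).mono_left nhdsWithin_le_nhds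
  refine le_of_tendsto hcont ?_
  have : Set.Ioo 0 β ∈ 𝓝[<] β := Ioo_mem_nhdsLT hβ
  filter_upwards [this] with β' hβ'
  exact (boxTwoPoint_le_spreadOutTwoPoint β' n x).trans (h β' hβ'.1.le hβ'.2)

/-! ### Susceptibility: elementary properties -/

/-- `χ_β ≥ 1` (the term `x = 0` is `G_β(0) = 1`). [cite: Sakai2007, §1.1 (definition of χ_p)] -/
theorem one_le_susceptibility (β : ℝ) : 1 ≤ spreadOutSusceptibility d L β :=
  calc (1 : ℝ≥0∞) = ENNReal.ofReal (spreadOutTwoPoint d L β 0) := by simp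
    _ ≤ spreadOutSusceptibility d L β := ENNReal.le_tsum 0

/-- `χ_β.toReal ≥ 1` whenever `χ_β < ∞`. [cite: Sakai2007, §1.1 (definition of χ_p)] -/
theorem one_le_susceptibility_toReal {β : ℝ} (h : spreadOutSusceptibility d L β < ∞) :
    1 ≤ (spreadOutSusceptibility d L β).toReal := by
  have h1 := one_le_susceptibility (d := d) (L := L) β
  have := (ENNReal.toReal_le_toReal ENNReal.one_ne_top h.ne).2 h1
  simpa using this

/-- **`χ_β` is nondecreasing in `β ≥ 0`** (termwise, from GKS II). [cite: FriedliVelenik2017, Exercise 3.9] -/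
theorem susceptibility_mono : MonotoneOn (spreadOutSusceptibility d L) (Set.Ici 0) := by
  intro β hβ β' hβ' hle
  exact ENNReal.tsum_le_tsum fun x =>
    ENNReal.ofReal_le_ofReal (spreadOutTwoPoint_mono_beta x hβ hβ' hle)

/-! ### The critical point `β_c = sup {β ≥ 0 : χ_β < ∞}` -/

/-- If `χ_β = ∞` for all `β ≥ β₁`, the set `{β ≥ 0 : χ_β < ∞}` defining `β_c` is bounded above
(by `β₁`). [cite: Sakai2007, §1.1 (χ_p = ∞ for p > p_c)] -/
theorem bddAbove_setOf_susceptibility_lt_top {β₁ : ℝ}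
    (h : ∀ β : ℝ, β₁ ≤ β → spreadOutSusceptibility d L β = ∞) :
    BddAbove {β : ℝ | 0 ≤ β ∧ spreadOutSusceptibility d L β < ∞} := by
  refine ⟨β₁, fun β hβ => ?_⟩
  by_contra hlt
  have htop := h β (le_of_not_ge hlt)
  exact absurd hβ.2 (by rw [htop]; exact lt_irrefl _)

/-- `χ_β < ∞` and `β ≥ 0` imply `β ≤ β_c` (when the defining set is bounded above).
[cite: Sakai2007, §1.1 (χ_p < ∞ iff p < p_c)] -/
theorem le_critBeta_of_susceptibility_lt_top {β₁ : ℝ}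
    (h : ∀ β : ℝ, β₁ ≤ β → spreadOutSusceptibility d L β = ∞) {β : ℝ} (hβ : 0 ≤ β)
    (hfin : spreadOutSusceptibility d L β < ∞) : β ≤ critBeta d L :=
  le_csSup (bddAbove_setOf_susceptibility_lt_top h) ⟨hβ, hfin⟩

/-- `β_c > 0` as soon as `χ_β < ∞` for some `β > 0` and `χ = ∞` eventually.
[cite: Sakai2007, §1.1 (p_c ∈ (0,∞))] -/
theorem critBeta_pos_of {β₁ : ℝ} (h : ∀ β : ℝ, β₁ ≤ β → spreadOutSusceptibility d L β = ∞)
    {β : ℝ} (hβ : 0 < β) (hfin : spreadOutSusceptibility d L β < ∞) : 0 < critBeta d L :=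
  hβ.trans_le (le_critBeta_of_susceptibility_lt_top h hβ.le hfin)

/-- **`χ_β < ∞` for `0 ≤ β < β_c`** (monotonicity of `χ` and the definition of `β_c` as a
supremum; the defining set must be nonempty). [cite: Sakai2007, §1.1 (χ_p < ∞ for p < p_c)] -/
theorem susceptibility_lt_top_of_lt_critBeta
    (hne : {β : ℝ | 0 ≤ β ∧ spreadOutSusceptibility d L β < ∞}.Nonempty) {β : ℝ} (hβ : 0 ≤ β)
    (hlt : β < critBeta d L) : spreadOutSusceptibility d L β < ∞ := by
  obtain ⟨β', ⟨hβ'0, hfin⟩, hββ'⟩ := exists_lt_of_lt_csSup hne hlt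
  exact lt_of_le_of_lt (susceptibility_mono hβ hβ'0 hββ'.le) hfin

/-- **`χ_β = ∞` for `β > β_c`**, `β ≥ 0` (when `χ = ∞` eventually, so that `β_c` is a genuine
supremum). [cite: Sakai2007, §1.1 (χ_p = ∞ for p > p_c)] -/
theorem susceptibility_eq_top_of_critBeta_lt {β₁ : ℝ}
    (h : ∀ β : ℝ, β₁ ≤ β → spreadOutSusceptibility d L β = ∞) {β : ℝ} (hβ : 0 ≤ β)
    (hlt : critBeta d L < β) : spreadOutSusceptibility d L β = ∞ := by
  by_contra hne
  exact absurd (le_critBeta_of_susceptibility_lt_top h hβ (lt_top_iff_ne_top.2 hne)) (not_le.2 hlt)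

/-! ### Named facts: the decomposition of `IsingBubbleMeanField` -/

/-- **High temperature (named fact).** For the uniformly spread-out Ising model on `ℤ^d` the
susceptibility is finite at some positive inverse temperature: `χ_β < ∞` for some `β > 0`.
This is the half `p_c > 0` of "When `d ≥ 2`, there exists a unique critical inverse temperature
`p_c ∈ (0,∞)` such that … the magnetic susceptibility `χ_p` is finite if `p < p_c`" (Sakai 2007,
§1.1, for `d ≥ 2` and translation-invariant `ℤ^d`-symmetric finite-range `J ≥ 0`; the
mechanism is the elementary high-temperature decay of the two-point function for `β` small,
e.g. Friedli–Velenik 2017, §3.7.3, eq. (3.49) and Exercise 3.24). Stated in Sakai's scope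
`d ≥ 2`, `L ≥ 1`. Named fact, not proved here.
[cite: Sakai2007, §1.1 (p_c ∈ (0,∞), χ_p < ∞ for p < p_c)]
[cite: FriedliVelenik2017, §3.7.3, eq. (3.49) and Exercise 3.24] -/
def exists_pos_susceptibility_lt_top : Prop :=
  ∀ d L : ℕ, 2 ≤ d → 1 ≤ L → ∃ β : ℝ, 0 < β ∧ spreadOutSusceptibility d L β < ∞

/-- **Low temperature (named fact).** For `d ≥ 2`, `L ≥ 1` the susceptibility of the uniformly
spread-out Ising model is infinite for all large `β`: the half `p_c < ∞`, "`χ_p = ∞` if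
`p > p_c`", of Sakai 2007, §1.1 (long-range order at low temperature, Peierls 1936; for the
free-boundary two-point function summed in `χ` this is `Σ_x G_β(x) = ∞`). In particular the set
`{β ≥ 0 : χ_β < ∞}` whose supremum is `critBeta d L` is bounded above. Named fact, not proved
here. [cite: Sakai2007, §1.1 (p_c ∈ (0,∞), χ_p = ∞ for p > p_c)] [cite: Peierls1936] -/
def exists_forall_le_susceptibility_eq_top : Prop :=
  ∀ d L : ℕ, 2 ≤ d → 1 ≤ L → ∃ β₁ : ℝ, ∀ β : ℝ, β₁ ≤ β → spreadOutSusceptibility d L β = ∞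

/-- **The mean-field bound `γ ≥ 1` in integrated form (named fact).** For the uniformly
spread-out Ising model, `0 ≤ β₁ ≤ β₂` and `χ_{β₂} < ∞`:
`χ_{β₁}⁻¹ - χ_{β₂}⁻¹ ≤ |J| (β₂ - β₁)`, where `|J| = Σ_x J_{0,x}` is the number of neighbours of
the origin (`= (2L+1)^d - 1`). This is the integrated form of the differential inequality
`∂χ/∂β ≤ |J| χ²`, printed as `∂_β χ ≤ 2dχ²` for the nearest-neighbour model in Duminil-Copin
2022, §7.1 (Lebowitz' inequality `U₄ ≤ 0` in the `β`-derivative of `Σ_x ⟨σ₀σ_x⟩`; Aizenman 1982;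
for `φ⁴`/Ising field theory "`0 ≤ dχ⁻¹/dσ ≤ 1`", Glimm–Jaffe 1987, Thm. 17.7.1 and its proof, with §17.4), which is
how the bound `γ ≥ 1` of Sakai 2007, §1.1 ("These exponents (if they exist) are known to obey
the mean-field bounds: `β ≤ 1/2`, `γ ≥ 1` and `δ ≥ 3`") is proved. The integrated form avoids
any differentiability statement for the infinite-volume `χ`. Named fact; provable from the
tree's finite-volume Lebowitz inequality and GKS monotonicity (see the file header).
[cite: DuminilCopinICM2022, §7.1 (∂_β χ ≤ 2dχ²)] [cite: Sakai2007, §1.1 (γ ≥ 1)]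
[cite: Aizenman1982, as cited by Sakai 2007 §1.1 ([a82])] [cite: GlimmJaffe1987, Thm. 17.7.1 (γ ≥ γ_cl = 1; 0 ≤ dχ⁻¹/dσ ≤ 1, §17.4)] -/
def inv_susceptibility_sub_le : Prop :=
  ∀ (d L : ℕ) (β₁ β₂ : ℝ), 0 ≤ β₁ → β₁ ≤ β₂ → spreadOutSusceptibility d L β₂ < ∞ →
    (spreadOutSusceptibility d L β₁).toReal⁻¹ - (spreadOutSusceptibility d L β₂).toReal⁻¹ ≤
      ((spreadOutGraph d L).degree 0 : ℝ) * (β₂ - β₁)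

/-- **Divergence of the susceptibility at `β_c` (named fact).** For `d ≥ 2`, `L ≥ 1`:
`χ_β → ∞` as `β ↑ β_c`, i.e. `χ` is unbounded on `[0, β_c)`: "The susceptibility `χ_p` is
known to diverge as `p ↑ p_c` [a82, ag83]" (Sakai 2007, §1.1; equivalently, by lower
semicontinuity of the monotone limit `G_β`, `χ_{β_c} = ∞`: finiteness of `χ` is an open
condition in `β`, Simon 1980 / Aizenman–Barsky–Fernández 1987). Named fact, not proved here.
[cite: Sakai2007, §1.1 (χ_p diverges as p ↑ p_c)] [cite: Aizenman1982, as cited by Sakai 2007 §1.1 ([a82])]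
[cite: AizenmanGraham1983, as cited by Sakai 2007 §1.1 ([ag83])]
[cite: AizenmanBarskyFernandezJSP1987, Thm. 1] -/
def susceptibility_unbounded_below_critBeta : Prop :=
  ∀ d L : ℕ, 2 ≤ d → 1 ≤ L → ∀ M : ℝ≥0∞, M < ∞ →
    ∃ β : ℝ, 0 ≤ β ∧ β < critBeta d L ∧ M ≤ spreadOutSusceptibility d L β

/-- **Bubble condition ⇒ `γ ≤ 1` (named fact; Aizenman 1982, Aizenman–Graham 1983 as quoted by
Sakai 2007, §1.1).** For the uniformly spread-out Ising model in `d ≥ 2`, `L ≥ 1`: if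
`B(β_c) = Σ_x G_{β_c}(x)² < ∞` then there are `C` and `β₀ < β_c` with `χ_β ≤ C (β_c - β)⁻¹` for
all `β ∈ (β₀, β_c)` — the upper half of "`χ_p ≍ (p_c - p)⁻¹`", i.e. of "the finiteness of
`Σ_{x∈ℤ^d} G_{p_c}(x)²` … implies that `β = 1/2`, `γ = 1` and `δ = 3` [a82, abf87, af86, ag83]"
(Sakai 2007, §1.1). Mechanism (printed for the nearest-neighbour model, `|J| = 2d`): the
random-current lower bound `(1 - B/χ)·2dχ²/(1+B) ≤ ∂_β χ` for `β < β_c`, so that "`B(β)`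
bounded uniformly in `β < β_c`" forces "`χ(β)` must blow up like `1/|β - β_c|`" (Duminil-Copin
2022, §7.1). This is the one ingredient of `IsingBubbleMeanField` whose proof (Aizenman's
differential inequality) is not available in the tree; the primary sources [a82], [ag83] are
cited through Sakai's statement. Named fact, not proved here.
[cite: Sakai2007, §1.1 (bubble condition ⇒ γ = 1)]
[cite: Aizenman1982, as cited by Sakai 2007 §1.1 ([a82])]
[cite: AizenmanGraham1983, as cited by Sakai 2007 §1.1 ([ag83])]
[cite: DuminilCopinICM2022, §7.1 (differential inequality for χ with the bubble diagram)] -/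
def bubble_susceptibility_upper : Prop :=
  ∀ d L : ℕ, 2 ≤ d → 1 ≤ L → BubbleCondition d L →
    ∃ C β₀ : ℝ, β₀ < critBeta d L ∧ ∀ β : ℝ, β₀ < β → β < critBeta d L →
      spreadOutSusceptibility d L β ≤ ENNReal.ofReal (C * (critBeta d L - β)⁻¹)

/-! ### Assembly: the five facts imply `IsingBubbleMeanField` -/

/-- **The lower bound `χ_β⁻¹ ≤ |J| (β_c - β)` on `[0, β_c)`** (`γ ≥ 1` with constant `1/|J|`),
from the integrated Lebowitz inequality (`inv_susceptibility_sub_le`) between `β` and points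
`β' ↑ β_c` along which `χ_{β'} → ∞` (`susceptibility_unbounded_below_critBeta`): the argument
"`∂(χ⁻¹)/∂β ≥ -|J|`, integrate up to `β_c` where `χ⁻¹ = 0`" behind `γ ≥ 1` (Sakai 2007, §1.1;
Duminil-Copin 2022, §7.1). [cite: Sakai2007, §1.1 (γ ≥ 1)] [cite: DuminilCopinICM2022, §7.1] -/
theorem toReal_susceptibility_inv_le (h3 : inv_susceptibility_sub_le)
    (h4 : susceptibility_unbounded_below_critBeta) (hd : 2 ≤ d) (hL : 1 ≤ L)
    (hne : {β : ℝ | 0 ≤ β ∧ spreadOutSusceptibility d L β < ∞}.Nonempty) {β : ℝ} (hβ : 0 ≤ β)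
    (hlt : β < critBeta d L) :
    (spreadOutSusceptibility d L β).toReal⁻¹ ≤
      ((spreadOutGraph d L).degree 0 : ℝ) * (critBeta d L - β) := by
  set D : ℝ := ((spreadOutGraph d L).degree 0 : ℝ) with hD
  have hD0 : 0 ≤ D := Nat.cast_nonneg _
  refine le_of_forall_pos_lt_add fun ε hε => ?_
  obtain ⟨β', hβ'0, hβ'c, hM⟩ := h4 d L hd hL (ENNReal.ofReal (2 / ε)) ENNReal.ofReal_lt_top
  have hfin' : spreadOutSusceptibility d L β' < ∞ :=
    susceptibility_lt_top_of_lt_critBeta hne hβ'0 hβ'c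
  -- `χ_{β'}⁻¹ ≤ ε / 2`
  have hinv' : (spreadOutSusceptibility d L β').toReal⁻¹ ≤ ε / 2 := by
    have h2ε : 2 / ε ≤ (spreadOutSusceptibility d L β').toReal :=
      (ENNReal.ofReal_le_iff_le_toReal hfin'.ne).1 hM
    calc (spreadOutSusceptibility d L β').toReal⁻¹ ≤ (2 / ε)⁻¹ := inv_anti₀ (by positivity) h2ε
      _ = ε / 2 := by rw [inv_div]
  rcases le_or_gt β' β with hle | hlt'
  · -- `χ_β ≥ χ_{β'}`, so `χ_β⁻¹ ≤ χ_{β'}⁻¹ ≤ ε/2`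
    have hfin : spreadOutSusceptibility d L β < ∞ :=
      susceptibility_lt_top_of_lt_critBeta hne hβ hlt
    have hmono : (spreadOutSusceptibility d L β').toReal ≤ (spreadOutSusceptibility d L β).toReal :=
      ENNReal.toReal_mono hfin.ne (susceptibility_mono hβ'0 hβ hle)
    have h1 : (spreadOutSusceptibility d L β).toReal⁻¹ ≤ (spreadOutSusceptibility d L β').toReal⁻¹ :=
      inv_anti₀ (by linarith [one_le_susceptibility_toReal hfin']) hmono
    have hnn : 0 ≤ D * (critBeta d L - β) := mul_nonneg hD0 (by linarith)
    linarith
  · have h3' := h3 d L β β' hβ hlt'.le hfin'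
    have hmul : D * (β' - β) ≤ D * (critBeta d L - β) :=
      mul_le_mul_of_nonneg_left (by linarith) hD0
    linarith

/-- **`IsingBubbleMeanField` from the five named facts.** For `d ≥ 2`, `L ≥ 1` and
`B(β_c) < ∞`: `0 < β_c` and `χ_β < ∞` below `β_c` (facts 1–2 with GKS monotonicity); the lower
bound `χ_β ≥ (|J|+1)⁻¹ (β_c - β)⁻¹` on `[0, β_c)` (facts 3–4, `toReal_susceptibility_inv_le`);
the upper bound `χ_β ≤ C (β_c - β)⁻¹` near `β_c` (fact 5). Hence `χ_β ≍ (β_c - β)⁻¹`,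
`HasGammaOne d L`. [cite: Sakai2007, §1.1 (bubble condition ⇒ γ = 1)] -/
theorem IsingBubbleMeanField_of_facts (h1 : exists_pos_susceptibility_lt_top)
    (h2 : exists_forall_le_susceptibility_eq_top) (h3 : inv_susceptibility_sub_le)
    (h4 : susceptibility_unbounded_below_critBeta) (h5 : bubble_susceptibility_upper) :
    IsingBubbleMeanField := by
  intro d L hd hL hB
  obtain ⟨βp, hβp, hfinp⟩ := h1 d L hd hL
  obtain ⟨β₁, hβ₁⟩ := h2 d L hd hL
  have hne : {β : ℝ | 0 ≤ β ∧ spreadOutSusceptibility d L β < ∞}.Nonempty := ⟨βp, hβp.le, hfinp⟩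
  have hpos : 0 < critBeta d L := critBeta_pos_of hβ₁ hβp hfinp
  obtain ⟨C, β₀, hβ₀, hup⟩ := h5 d L hd hL hB
  set D : ℝ := ((spreadOutGraph d L).degree 0 : ℝ) with hD
  have hD0 : 0 ≤ D := Nat.cast_nonneg _
  refine ⟨(D + 1)⁻¹, C, max β₀ 0, by positivity, max_lt hβ₀ hpos, fun β hβl hβc => ⟨?_, ?_⟩⟩
  · -- lower bound
    have hβ0 : 0 ≤ β := ((le_max_right _ _).trans_lt hβl).le
    have hfin : spreadOutSusceptibility d L β < ∞ :=
      susceptibility_lt_top_of_lt_critBeta hne hβ0 hβc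
    have hinv := toReal_susceptibility_inv_le h3 h4 hd hL hne hβ0 hβc
    have hgap : 0 < critBeta d L - β := sub_pos.2 hβc
    have hχ : 0 < (spreadOutSusceptibility d L β).toReal := by
      linarith [one_le_susceptibility_toReal hfin]
    rw [← ENNReal.ofReal_toReal hfin.ne]
    refine ENNReal.ofReal_le_ofReal ?_
    have h' : (spreadOutSusceptibility d L β).toReal⁻¹ ≤ (D + 1) * (critBeta d L - β) :=
      hinv.trans (by nlinarith)
    rw [← mul_inv]
    calc ((D + 1) * (critBeta d L - β))⁻¹ ≤ ((spreadOutSusceptibility d L β).toReal⁻¹)⁻¹ :=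
          inv_anti₀ (by positivity) h'
      _ = (spreadOutSusceptibility d L β).toReal := inv_inv _
  · exact hup β ((le_max_left _ _).trans_lt hβl) hβc

/-! ## Towards fact 3: the integrated Lebowitz inequality

### Step A. Lebowitz' bound on the covariance of two pair observables at zero field (sharp form)

At zero field all one-spin averages vanish, so in the duplicated system `Σ Σ T_uT_v ww = 2Z·Z⟨σ_uσ_v⟩`
and `Σ Σ Q_pQ_r ww = 2Z·Z⟨σ_pσ_r⟩` exactly, and `lebowitz_pair` (`LebowitzInequality`) yields the
sharp `⟨σ_aσ_z σ_xσ_y⟩ - ⟨σ_aσ_z⟩⟨σ_xσ_y⟩ ≤ ⟨σ_aσ_x⟩⟨σ_yσ_z⟩ + ⟨σ_aσ_y⟩⟨σ_xσ_z⟩`, i.e.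
`U₄ ≤ 0` (Lebowitz 1974; Glimm–Jaffe 1987, Cor. 4.3.2–4.3.3), instead of the factor `2` of
`gksExpect_cov_spinPair_le` (valid for `h ≥ 0`). -/

section SharpLebowitz

variable {Ω : Type*} [Fintype Ω] [DecidableEq Ω] {ι : Type*}
variable (s : Finset ι) (K : ι → ℝ) (C : ι → Finset Ω)

/-- One Lebowitz term at zero field: `ΣΣ T_uT_vQ_pQ_r ww ≤ 4 (Z⟨σ_pσ_r⟩)(Z⟨σ_uσ_v⟩)` when all
one-spin sums vanish (then `ΣΣ T_uT_v ww = 2Z(Z⟨σ_uσ_v⟩)`, `ΣΣ Q_pQ_r ww = 2Z(Z⟨σ_pσ_r⟩)`).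
[cite: GlimmJaffe1987, Cor. 4.3.2] [cite: Lebowitz1974, Theorem, eq. (2.5b)] -/
theorem gksSum2_ttqq_le_of_spinAt_eq_zero (hK : ∀ i ∈ s, 0 ≤ K i)
    (hC : ∀ i ∈ s, (C i).card ≤ 2) (hodd : ∀ u : Ω, gksSum s K C (fun σ => spinAt u σ) = 0)
    (u v p r : Ω) :
    gksSum2 s K C (fun ξ χ => tVar2 u ξ χ * tVar2 v ξ χ * (qVar2 p ξ χ * qVar2 r ξ χ)) ≤
      4 * (gksSum s K C (spinPair p r) * gksSum s K C (spinPair u v)) := by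
  have hZ := gksSum_one_pos s K C
  have hleb := lebowitz_pair s K C hK hC u v p r
  rw [gksSum2_one] at hleb
  have hT : gksSum2 s K C (fun ξ χ => tVar2 u ξ χ * tVar2 v ξ χ) =
      2 * (gksSum s K C (spinPair u v) * gksSum s K C (fun _ => 1)) := by
    rw [gksSum2_tVar2_mul, hodd u, hodd v]; ring
  have hQ : gksSum2 s K C (fun ξ χ => qVar2 p ξ χ * qVar2 r ξ χ) =
      2 * (gksSum s K C (spinPair p r) * gksSum s K C (fun _ => 1)) := by
    rw [gksSum2_qVar2_mul, hodd p, hodd r]; ring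
  rw [hT, hQ] at hleb
  have hZ2 : 0 < gksSum s K C (fun _ => 1) * gksSum s K C (fun _ => 1) := mul_pos hZ hZ
  refine le_of_mul_le_mul_right ?_ hZ2
  calc _ ≤ _ := hleb
    _ = 4 * (gksSum s K C (spinPair p r) * gksSum s K C (spinPair u v)) *
          (gksSum s K C (fun _ => 1) * gksSum s K C (fun _ => 1)) := by ring

/-- **Lebowitz' inequality at zero field, pair form (sharp)**: when all one-spin sums vanish,
`⟨σ_aσ_z σ_xσ_y⟩ - ⟨σ_aσ_z⟩⟨σ_xσ_y⟩ ≤ ⟨σ_aσ_x⟩⟨σ_yσ_z⟩ + ⟨σ_aσ_y⟩⟨σ_xσ_z⟩` for couplings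
`Kᵢ ≥ 0` on supports of at most two sites, i.e. `U₄(a,z,x,y) ≤ 0` (Lebowitz 1974; Glimm–Jaffe
1987, Cor. 4.3.2 and Cor. 4.3.3). [cite: Lebowitz1974, Theorem, eq. (2.5b)]
[cite: GlimmJaffe1987, Cor. 4.3.2 and Cor. 4.3.3] -/
theorem gksExpect_cov_spinPair_le_of_spinAt_eq_zero (hK : ∀ i ∈ s, 0 ≤ K i)
    (hC : ∀ i ∈ s, (C i).card ≤ 2) (hodd : ∀ u : Ω, gksSum s K C (fun σ => spinAt u σ) = 0)
    (a z x y : Ω) :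
    gksExpect s K C (fun σ => spinPair a z σ * spinPair x y σ) -
        gksExpect s K C (spinPair a z) * gksExpect s K C (spinPair x y) ≤
      gksExpect s K C (spinPair a x) * gksExpect s K C (spinPair y z) +
        gksExpect s K C (spinPair a y) * gksExpect s K C (spinPair x z) := by
  have hZ := gksSum_one_pos s K C
  set Z := gksSum s K C (fun _ => 1) with hZdef
  have hcov := cov_spinPair_eq_gksSum2 s K C a z x y
  have h1 := gksSum2_ttqq_le_of_spinAt_eq_zero s K C hK hC hodd z y a x
  have h2 := gksSum2_ttqq_le_of_spinAt_eq_zero s K C hK hC hodd z x a y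
  have h3 := gksSum2_ttqq_le_of_spinAt_eq_zero s K C hK hC hodd a y z x
  have h4 := gksSum2_ttqq_le_of_spinAt_eq_zero s K C hK hC hodd a x z y
  have hun : Z * gksSum s K C (fun σ => spinPair a z σ * spinPair x y σ) -
      gksSum s K C (spinPair a z) * gksSum s K C (spinPair x y) ≤
      gksSum s K C (spinPair a x) * gksSum s K C (spinPair y z) +
        gksSum s K C (spinPair a y) * gksSum s K C (spinPair x z) := by
    rw [spinPair_comm z y] at h1 h4
    rw [spinPair_comm z x] at h2 h3
    rw [hZdef, hcov]
    linarith
  have hL : gksExpect s K C (fun σ => spinPair a z σ * spinPair x y σ) -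
      gksExpect s K C (spinPair a z) * gksExpect s K C (spinPair x y) =
      (Z * gksSum s K C (fun σ => spinPair a z σ * spinPair x y σ) -
        gksSum s K C (spinPair a z) * gksSum s K C (spinPair x y)) / (Z * Z) := by
    simp only [gksExpect, ← hZdef]
    field_simp
  have hR : gksExpect s K C (spinPair a x) * gksExpect s K C (spinPair y z) +
      gksExpect s K C (spinPair a y) * gksExpect s K C (spinPair x z) =
      (gksSum s K C (spinPair a x) * gksSum s K C (spinPair y z) +
        gksSum s K C (spinPair a y) * gksSum s K C (spinPair x z)) / (Z * Z) := by
    simp only [gksExpect, ← hZdef]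
    field_simp
  rw [hL, hR]
  exact div_le_div_of_nonneg_right hun (mul_pos hZ hZ).le

end SharpLebowitz

section IsingLebowitz

variable {V : Type*} [DecidableEq V] (G : SimpleGraph V) [G.LocallyFinite]

/-- `⟨σ_aσ_z σ_xσ_y⟩^{bc}_{Λ;β,h}` as an expectation of the spin system `ν_{Λ;K}` of
`GKSInequalities` (companion of `isingTwoPoint_eq_gksExpect`), for `a, z, x, y ∈ Λ`.
[cite: FriedliVelenik2017, §3.8.1, p. 141] -/
theorem isingExpect_spinPair_mul_eq_gksExpect (Λ : Finset V) (β h : ℝ) (bc : BoundaryCondition V)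
    {a z x y : V} (ha : a ∈ Λ) (hz : z ∈ Λ) (hx : x ∈ Λ) (hy : y ∈ Λ) :
    isingExpect G Λ β h bc (fun σ => spinPair a z σ * spinPair x y σ) =
      gksExpect (isingIdx G Λ) (gksCoupling G Λ β h bc) (isingSupp Λ)
        (fun τ => spinPair (⟨a, ha⟩ : ↥Λ) ⟨z, hz⟩ τ * spinPair (⟨x, hx⟩ : ↥Λ) ⟨y, hy⟩ τ) := by
  rw [isingExpect, integral_isingMeasure G Λ β h bc
      (show Measurable (fun σ => spinPair a z σ * spinPair x y σ) from
        (measurable_spinPair a z).mul (measurable_spinPair x y)), gksExpect, gksSum, gksSum,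
    isingPartitionFunction]
  congr 1
  · refine Finset.sum_congr rfl fun τ _ => ?_
    rw [isingWeight_eq_gksWeight, spinPair, spinPair, spinAt_glue_of_mem τ bc ha,
      spinAt_glue_of_mem τ bc hz, spinAt_glue_of_mem τ bc hx, spinAt_glue_of_mem τ bc hy,
      spinPair, spinPair, mul_comm]
  · refine Finset.sum_congr rfl fun τ _ => ?_
    rw [isingWeight_eq_gksWeight, one_mul]

/-- At zero field and free boundary condition every one-spin sum of the spin system vanishes
(spin flip; the interaction terms have even support or zero coupling).
[cite: FriedliVelenik2017, Exercise 3.16 (solution, p. 566: spin-flip identity)] -/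
theorem gksSum_ising_free_spinAt_eq_zero (Λ : Finset V) (β : ℝ) (u : ↥Λ) :
    gksSum (isingIdx G Λ) (gksCoupling G Λ β 0 .free) (isingSupp Λ) (fun σ => spinAt u σ) = 0 := by
  refine gksSum_spinAt_eq_zero_of_even _ _ _ _ ?_
  rintro (e | x) hi
  · by_cases he : e ∈ edgesIn G Λ
    · right
      have he' := (mem_edgesIn_iff.1 he)
      induction e using Sym2.ind with
      | _ a b =>
        have hab : G.Adj a b := (SimpleGraph.mem_edgeSet G).1 he'.1
        have ha : a ∈ Λ := he'.2 a (Sym2.mem_mk_left a b)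
        have hb : b ∈ Λ := he'.2 b (Sym2.mem_mk_right a b)
        have hset : isingSupp Λ (Sum.inl s(a, b)) = {(⟨a, ha⟩ : ↥Λ), ⟨b, hb⟩} := by
          ext w
          simp only [isingSupp, Finset.mem_filter, Finset.mem_univ, true_and, Sym2.mem_iff,
            Finset.mem_insert, Finset.mem_singleton, Subtype.ext_iff]
        rw [hset, Finset.card_pair]
        · exact even_two
        · intro h
          exact G.ne_of_adj hab (congrArg Subtype.val h)
    · left
      simp [gksCoupling, interactionEdges_free, he]
  · left
    simp [gksCoupling]

/-- **Lebowitz' inequality for the finite-volume Ising model, free boundary condition, zero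
field, `β ≥ 0`** (sharp pair form of `U₄ ≤ 0`): for `a, z, x, y ∈ Λ`,
`⟨σ_aσ_z σ_xσ_y⟩ - ⟨σ_aσ_z⟩⟨σ_xσ_y⟩ ≤ ⟨σ_aσ_x⟩⟨σ_yσ_z⟩ + ⟨σ_aσ_y⟩⟨σ_xσ_z⟩`
(Lebowitz 1974; Glimm–Jaffe 1987, Cor. 4.3.3). [cite: Lebowitz1974, Theorem, eq. (2.5b)]
[cite: GlimmJaffe1987, Cor. 4.3.3] -/
theorem isingExpect_cov_spinPair_le {Λ : Finset V} {β : ℝ} (hβ : 0 ≤ β) {a z x y : V}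
    (ha : a ∈ Λ) (hz : z ∈ Λ) (hx : x ∈ Λ) (hy : y ∈ Λ) :
    isingExpect G Λ β 0 .free (fun σ => spinPair a z σ * spinPair x y σ) -
        isingTwoPoint G Λ β 0 .free a z * isingTwoPoint G Λ β 0 .free x y ≤
      isingTwoPoint G Λ β 0 .free a x * isingTwoPoint G Λ β 0 .free y z +
        isingTwoPoint G Λ β 0 .free a y * isingTwoPoint G Λ β 0 .free x z := by
  rw [isingExpect_spinPair_mul_eq_gksExpect G Λ β 0 .free ha hz hx hy,
    isingTwoPoint_eq_gksExpect G Λ β 0 .free ha hz, isingTwoPoint_eq_gksExpect G Λ β 0 .free hx hy,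
    isingTwoPoint_eq_gksExpect G Λ β 0 .free ha hx, isingTwoPoint_eq_gksExpect G Λ β 0 .free hy hz,
    isingTwoPoint_eq_gksExpect G Λ β 0 .free ha hy, isingTwoPoint_eq_gksExpect G Λ β 0 .free hx hz]
  exact gksExpect_cov_spinPair_le_of_spinAt_eq_zero _ _ _
    (gksCoupling_nonneg G hβ le_rfl (Or.inl rfl)) (fun i _ => card_isingSupp_le_two Λ i)
    (fun u => gksSum_ising_free_spinAt_eq_zero G Λ β u) _ _ _ _

end IsingLebowitz

/-! ### Step B. The `β`-derivative of a finite-volume two-point function is at most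
`Σ_{u ∼ v} ⟨σ_aσ_u⟩⟨σ_xσ_v⟩` -/

section DerivativeBound

variable {V : Type*} [DecidableEq V] (G : SimpleGraph V) [G.LocallyFinite]

/-- `⟨σ_xσ_y⟩ = ⟨σ_yσ_x⟩`. [folklore] -/
theorem isingTwoPoint_comm (Λ : Finset V) (β h : ℝ) (bc : BoundaryCondition V) (x y : V) :
    isingTwoPoint G Λ β h bc x y = isingTwoPoint G Λ β h bc y x := by
  simp only [isingTwoPoint, spinPair_comm x y]

/-- `⟨σ_xσ_y⟩^∅_{Λ;β,0} ≥ 0` for `β ≥ 0`, `x, y ∈ Λ` (GKS I). [cite: FriedliVelenik2017, Thm. 3.20, eq. (3.21), p. 109] -/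
theorem isingTwoPoint_free_nonneg {Λ : Finset V} {β : ℝ} (hβ : 0 ≤ β) {x y : V} (hx : x ∈ Λ)
    (hy : y ∈ Λ) : 0 ≤ isingTwoPoint G Λ β 0 .free x y := by
  by_cases hxy : x = y
  · subst hxy; simp
  · rw [isingTwoPoint_eq_isingCorr G Λ β 0 .free hxy]
    refine Literature.Probability.LatticeModels.GKSInequalities.gks_one_holds G hβ le_rfl (Or.inl rfl) ?_
    intro w hw
    rcases Finset.mem_insert.1 hw with rfl | hw
    · exact hx
    · rw [Finset.mem_singleton.1 hw]; exact hy

/-- `β ↦ ⟨σ_xσ_y⟩^∅_{Λ;β,0}` is nondecreasing on `[0,∞)` for `x, y ∈ Λ` (GKS II).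
[cite: FriedliVelenik2017, Exercise 3.9] -/
theorem isingTwoPoint_free_mono_beta {Λ : Finset V} {x y : V} (hx : x ∈ Λ) (hy : y ∈ Λ) :
    MonotoneOn (fun β => isingTwoPoint G Λ β 0 .free x y) (Set.Ici 0) := by
  intro β hβ β' hβ' hle
  by_cases hxy : x = y
  · subst hxy; simp
  · simp only [isingTwoPoint_eq_isingCorr G Λ _ 0 .free hxy]
    refine Literature.Probability.LatticeModels.monotoneOn_isingCorr_free G (fun Λ A B β h bc => Literature.Probability.LatticeModels.GKSInequalities.gks_two_holds _)
      le_rfl ?_ hβ hβ' hle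
    intro w hw
    rcases Finset.mem_insert.1 hw with rfl | hw
    · exact hx
    · rw [Finset.mem_singleton.1 hw]; exact hy

/-- Volume monotonicity of `⟨σ_xσ_y⟩^∅_{Λ;β,0}` for `x, y ∈ Λ₁ ⊆ Λ₂`, `β ≥ 0` (GKS II).
[cite: FriedliVelenik2017, Exercise 3.12] -/
theorem isingTwoPoint_free_le_of_subset {Λ₁ Λ₂ : Finset V} {β : ℝ} (hβ : 0 ≤ β) {x y : V}
    (hx : x ∈ Λ₁) (hy : y ∈ Λ₁) (h12 : Λ₁ ⊆ Λ₂) :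
    isingTwoPoint G Λ₁ β 0 .free x y ≤ isingTwoPoint G Λ₂ β 0 .free x y := by
  by_cases hxy : x = y
  · subst hxy; simp
  · rw [isingTwoPoint_eq_isingCorr G Λ₁ β 0 .free hxy, isingTwoPoint_eq_isingCorr G Λ₂ β 0 .free hxy]
    refine isingCorr_free_le_of_subset G hβ le_rfl ?_ h12
    intro w hw
    rcases Finset.mem_insert.1 hw with rfl | hw
    · exact hx
    · rw [Finset.mem_singleton.1 hw]; exact hy

variable [DecidableRel G.Adj]

/-- Edge sums versus ordered-pair sums: for any `g`,
`Σ_{e = {u,v} ∈ ℰ_Λ} (g(u,v) + g(v,u)) = Σ_{u ∈ Λ} Σ_{v ∈ Λ, v ∼ u} g(u,v)` (each edge inside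
`Λ` is counted once with each orientation). [folklore] -/
theorem sum_edgesIn_lift_eq {M : Type*} [AddCommMonoid M] (Λ : Finset V) (g : V → V → M) :
    ∑ e ∈ edgesIn G Λ, Sym2.lift ⟨fun u v => g u v + g v u, fun _ _ => add_comm _ _⟩ e =
      ∑ u ∈ Λ, ∑ v ∈ Λ with G.Adj u v, g u v := by
  -- the ordered adjacent pairs inside `Λ`
  set D : Finset (V × V) := (Λ ×ˢ Λ).filter fun p => G.Adj p.1 p.2 with hD
  have hRHS : ∑ u ∈ Λ, ∑ v ∈ Λ with G.Adj u v, g u v = ∑ p ∈ D, g p.1 p.2 := by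
    rw [hD, Finset.sum_filter, Finset.sum_product]
    refine Finset.sum_congr rfl fun u _ => ?_
    rw [Finset.sum_filter]
  have hmaps : ∀ p ∈ D, s(p.1, p.2) ∈ edgesIn G Λ := by
    intro p hp
    rw [hD, Finset.mem_filter, Finset.mem_product] at hp
    rw [mem_edgesIn_iff]
    refine ⟨(SimpleGraph.mem_edgeSet G).2 hp.2, fun w hw => ?_⟩
    rcases Sym2.mem_iff.1 hw with rfl | rfl
    · exact hp.1.1
    · exact hp.1.2
  rw [hRHS, ← Finset.sum_fiberwise_of_maps_to hmaps]
  refine Finset.sum_congr rfl fun e he => ?_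
  have he' := mem_edgesIn_iff.1 he
  induction e using Sym2.ind with
  | _ a b =>
    have hab : G.Adj a b := (SimpleGraph.mem_edgeSet G).1 he'.1
    have ha : a ∈ Λ := he'.2 a (Sym2.mem_mk_left a b)
    have hb : b ∈ Λ := he'.2 b (Sym2.mem_mk_right a b)
    have hne : (a, b) ≠ (b, a) := fun h => G.ne_of_adj hab (Prod.ext_iff.1 h).1
    have hfib : D.filter (fun p => s(p.1, p.2) = s(a, b)) = {(a, b), (b, a)} := by
      ext p
      simp only [hD, Finset.mem_filter, Finset.mem_product, Finset.mem_insert,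
        Finset.mem_singleton, Sym2.eq_iff]
      constructor
      · rintro ⟨-, ⟨h1, h2⟩ | ⟨h1, h2⟩⟩
        · left; exact Prod.ext h1 h2
        · right; exact Prod.ext h1 h2
      · rintro (rfl | rfl)
        · exact ⟨⟨⟨ha, hb⟩, hab⟩, Or.inl ⟨rfl, rfl⟩⟩
        · exact ⟨⟨⟨hb, ha⟩, hab.symm⟩, Or.inr ⟨rfl, rfl⟩⟩
    rw [hfib, Finset.sum_pair hne]
    rfl

/-- **`∂_β ⟨σ_aσ_x⟩^∅_{Λ;β,0} ≤ Σ_{u ∈ Λ} Σ_{v ∈ Λ, v ∼ u} ⟨σ_aσ_u⟩⟨σ_xσ_v⟩`** for `β ≥ 0`,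
`a, x ∈ Λ`: the derivative is the sum over the edges `{u,v}` inside `Λ` of the covariances
`⟨σ_uσ_v σ_aσ_x⟩ - ⟨σ_uσ_v⟩⟨σ_aσ_x⟩` (`hasDerivAt_isingExpect`), each at most
`⟨σ_aσ_u⟩⟨σ_xσ_v⟩ + ⟨σ_aσ_v⟩⟨σ_xσ_u⟩` by Lebowitz' inequality (the finite-volume form of
`∂_β χ ≤ |J| χ²`, Duminil-Copin 2022, §7.1). [cite: DuminilCopinICM2022, §7.1 (∂_β χ ≤ 2dχ²)]
[cite: GlimmJaffe1987, Cor. 4.3.3] -/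
theorem deriv_isingTwoPoint_free_le {Λ : Finset V} {β : ℝ} (hβ : 0 ≤ β) {a x : V} (ha : a ∈ Λ)
    (hx : x ∈ Λ) :
    deriv (fun β => isingTwoPoint G Λ β 0 .free a x) β ≤
      ∑ u ∈ Λ, ∑ v ∈ Λ with G.Adj u v,
        isingTwoPoint G Λ β 0 .free a u * isingTwoPoint G Λ β 0 .free x v := by
  have hD := hasDerivAt_isingExpect G Λ 0 .free β (measurable_spinPair a x)
  have hH := isingExpect_negHamiltonian_mul G Λ 0 .free β (f := fun _ => (1 : ℝ)) measurable_const
  simp only [mul_one] at hH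
  change deriv (fun β => isingExpect G Λ β 0 .free (spinPair a x)) β ≤ _
  rw [hD.deriv, isingExpect_negHamiltonian_mul G Λ 0 .free β (measurable_spinPair a x), hH]
  simp only [interactionEdges_free, zero_mul, add_zero, Finset.sum_mul, ← Finset.sum_sub_distrib]
  rw [← sum_edgesIn_lift_eq G Λ (fun u v =>
    isingTwoPoint G Λ β 0 .free a u * isingTwoPoint G Λ β 0 .free x v)]
  refine Finset.sum_le_sum fun e he => ?_
  have he' := mem_edgesIn_iff.1 he
  induction e using Sym2.ind with
  | _ u v =>
    have hu : u ∈ Λ := he'.2 u (Sym2.mem_mk_left u v)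
    have hv : v ∈ Λ := he'.2 v (Sym2.mem_mk_right u v)
    simp only [Sym2.lift_mk, bondSpin_mk]
    have hcov := isingExpect_cov_spinPair_le G hβ hu hv ha hx
    have h1 : isingExpect G Λ β 0 .free (fun σ => spinAt u σ * spinAt v σ * spinPair a x σ) =
        isingExpect G Λ β 0 .free (fun σ => spinPair u v σ * spinPair a x σ) := rfl
    have h2 : isingExpect G Λ β 0 .free (fun σ => spinAt u σ * spinAt v σ) =
        isingTwoPoint G Λ β 0 .free u v := rfl
    have h3 : isingExpect G Λ β 0 .free (spinPair a x) = isingTwoPoint G Λ β 0 .free a x := rfl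
    rw [h1, h2, h3]
    rw [isingTwoPoint_comm G Λ β 0 .free u a, isingTwoPoint_comm G Λ β 0 .free u x] at hcov
    linarith

/-- **Increment bound in finite volume**: for `0 ≤ β₁ ≤ β₂` and `a, x ∈ Λ`,
`⟨σ_aσ_x⟩_{Λ;β₂} - ⟨σ_aσ_x⟩_{Λ;β₁} ≤ (Σ_{u∈Λ} Σ_{v∈Λ, v∼u} ⟨σ_aσ_u⟩_{Λ;β₂}⟨σ_xσ_v⟩_{Λ;β₂})·(β₂ - β₁)`
(mean value inequality with the derivative bound, the two-point functions being nonnegative and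
nondecreasing in `β`). [cite: DuminilCopinICM2022, §7.1 (∂_β χ ≤ 2dχ²)] -/
theorem isingTwoPoint_free_sub_le {Λ : Finset V} {β₁ β₂ : ℝ} (h0 : 0 ≤ β₁) (h12 : β₁ ≤ β₂)
    {a x : V} (ha : a ∈ Λ) (hx : x ∈ Λ) :
    isingTwoPoint G Λ β₂ 0 .free a x - isingTwoPoint G Λ β₁ 0 .free a x ≤
      (∑ u ∈ Λ, ∑ v ∈ Λ with G.Adj u v,
        isingTwoPoint G Λ β₂ 0 .free a u * isingTwoPoint G Λ β₂ 0 .free x v) * (β₂ - β₁) := by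
  set Cst := ∑ u ∈ Λ, ∑ v ∈ Λ with G.Adj u v,
    isingTwoPoint G Λ β₂ 0 .free a u * isingTwoPoint G Λ β₂ 0 .free x v with hCst
  have hcont : ContinuousOn (fun β => isingTwoPoint G Λ β 0 .free a x) (Set.Icc β₁ β₂) :=
    (continuous_isingExpect G Λ 0 .free (measurable_spinPair a x)).continuousOn
  have hdiff : DifferentiableOn ℝ (fun β => isingTwoPoint G Λ β 0 .free a x)
      (interior (Set.Icc β₁ β₂)) := fun β _ =>
    (hasDerivAt_isingExpect G Λ 0 .free β
      (measurable_spinPair a x)).differentiableAt.differentiableWithinAt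
  have hbound : ∀ β ∈ interior (Set.Icc β₁ β₂),
      deriv (fun β => isingTwoPoint G Λ β 0 .free a x) β ≤ Cst := by
    intro β hβ
    rw [interior_Icc] at hβ
    have hβ0 : 0 ≤ β := h0.trans hβ.1.le
    refine (deriv_isingTwoPoint_free_le G hβ0 ha hx).trans ?_
    refine Finset.sum_le_sum fun u hu => Finset.sum_le_sum fun v hv => ?_
    have hv' : v ∈ Λ := (Finset.mem_filter.1 hv).1
    have hβ2 : (0 : ℝ) ≤ β₂ := hβ0.trans hβ.2.le
    exact mul_le_mul (isingTwoPoint_free_mono_beta G ha hu hβ0 hβ2 hβ.2.le)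
      (isingTwoPoint_free_mono_beta G hx hv' hβ0 hβ2 hβ.2.le)
      (isingTwoPoint_free_nonneg G hβ0 hx hv') (isingTwoPoint_free_nonneg G hβ2 ha hu)
  have := (convex_Icc β₁ β₂).image_sub_le_mul_sub_of_deriv_le hcont hdiff hbound β₁
    (Set.left_mem_Icc.2 h12) β₂ (Set.right_mem_Icc.2 h12) h12
  linarith

end DerivativeBound

/-! ### Step C. The spread-out model: translation, the increment bound for `G_β`, and the
summation over `x` -/

/-- The range-`L` graph is translation invariant. [cite: Sakai2007, §1.1 (translation-invariant couplings)] -/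
theorem spreadOutGraph_adj_shift_iff (d L : ℕ) (w p q : Site d) :
    (spreadOutGraph d L).Adj (Site.shift w p) (Site.shift w q) ↔ (spreadOutGraph d L).Adj p q := by
  simp only [spreadOutGraph_adj_iff, Site.shift_apply, Pi.add_apply, add_sub_add_right_eq_sub,
    ne_eq, add_left_inj]

/-- Adjacency depends only on the difference: `u ∼ v ↔ 0 ∼ v - u`. [cite: Sakai2007, §1.1 (translation-invariant couplings)] -/
theorem spreadOutGraph_adj_iff_sub (d L : ℕ) (u v : Site d) :
    (spreadOutGraph d L).Adj u v ↔ (spreadOutGraph d L).Adj 0 (v - u) := by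
  have h := spreadOutGraph_adj_shift_iff d L u 0 (v - u)
  simp only [Site.shift_apply, zero_add, sub_add_cancel] at h
  exact h

/-- The neighbourhood of `u` is the translate of the neighbourhood of `0`. [cite: Sakai2007, §1.1 (translation-invariant couplings)] -/
theorem neighborFinset_spreadOutGraph_eq_map (d L : ℕ) (u : Site d) :
    (spreadOutGraph d L).neighborFinset u =
      ((spreadOutGraph d L).neighborFinset 0).map (Site.shift u).toEmbedding := by
  ext v
  rw [SimpleGraph.mem_neighborFinset, mem_map_shift_iff', SimpleGraph.mem_neighborFinset,
    spreadOutGraph_adj_iff_sub d L u v]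

/-- Every site has `|J| = deg 0` neighbours (`= (2L+1)^d - 1`). [cite: Sakai2007, §1.2 (uniformly spread-out interaction)] -/
theorem card_neighborFinset_spreadOutGraph (d L : ℕ) (u : Site d) :
    ((spreadOutGraph d L).neighborFinset u).card = (spreadOutGraph d L).degree 0 := by
  rw [neighborFinset_spreadOutGraph_eq_map, Finset.card_map, SimpleGraph.card_neighborFinset_eq_degree]

/-- **Translation and the infinite-volume majorant**: for `β ≥ 0` and `x, v ∈ Λ_n`,
`⟨σ_xσ_v⟩^∅_{Λ_n;β} ≤ G_β(v - x)` (transport by `-x`, then volume monotonicity into the centred box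
`Λ_{n+‖x‖} ⊇ Λ_n - x`). [cite: Sakai2007, §1.1 (translation invariance, monotone limit)] -/
theorem isingTwoPoint_box_le_spreadOutTwoPoint {β : ℝ} (hβ : 0 ≤ β) {n : ℕ} {x v : Site d}
    (hx : x ∈ box d n) (hv : v ∈ box d n) :
    isingTwoPoint (spreadOutGraph d L) (box d n) β 0 .free x v ≤ spreadOutTwoPoint d L β (v - x) := by
  set φ := (Site.shift (-x)).toEmbedding with hφ
  have hmap := isingTwoPoint_free_map (G := spreadOutGraph d L) (G' := spreadOutGraph d L) φ
    (Λ := box d n) (fun p _ q _ => spreadOutGraph_adj_shift_iff d L (-x) p q) β 0 x v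
  have hφx : φ x = 0 := by simp [hφ]
  have hφv : φ v = v - x := by simp [hφ, sub_eq_add_neg]
  rw [hφx, hφv] at hmap
  rw [← hmap]
  have hsub : (box d n).map φ ⊆ box d (n + Site.supNorm (-x)) := map_shift_box_subset n (-x)
  have h0 : (0 : Site d) ∈ (box d n).map φ := hφx ▸ Finset.mem_map_of_mem φ hx
  have hvx : v - x ∈ (box d n).map φ := hφv ▸ Finset.mem_map_of_mem φ hv
  calc isingTwoPoint (spreadOutGraph d L) ((box d n).map φ) β 0 .free 0 (v - x)
      ≤ isingTwoPoint (spreadOutGraph d L) (box d (n + Site.supNorm (-x))) β 0 .free 0 (v - x) :=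
        isingTwoPoint_free_le_of_subset _ hβ h0 hvx hsub
    _ ≤ spreadOutTwoPoint d L β (v - x) := boxTwoPoint_le_spreadOutTwoPoint β _ _

/-- **The increment bound for `G_β`**: for `0 ≤ β₁ ≤ β₂`,
`G_{β₂}(x) ≤ G_{β₁}(x) + (β₂ - β₁) Ψ_{β₂}(x)` in `[0, ∞]`, with the kernel
`Ψ_β(x) = Σ_u Σ_{v ∼ u} G_β(u) G_β(v - x)` — the finite-volume increment bound
(`isingTwoPoint_free_sub_le`) with its right-hand side majorised by infinite-volume quantities
at `β₂` (monotonicity in the volume and in `β`, translation), then `n → ∞` on the left.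
[cite: DuminilCopinICM2022, §7.1 (∂_β χ ≤ 2dχ²)] -/
theorem ofReal_spreadOutTwoPoint_le_add {β₁ β₂ : ℝ} (h0 : 0 ≤ β₁) (h12 : β₁ ≤ β₂) (x : Site d) :
    ENNReal.ofReal (spreadOutTwoPoint d L β₂ x) ≤
      ENNReal.ofReal (spreadOutTwoPoint d L β₁ x) + ENNReal.ofReal (β₂ - β₁) *
        ∑' u : Site d, ∑ v ∈ (spreadOutGraph d L).neighborFinset u,
          ENNReal.ofReal (spreadOutTwoPoint d L β₂ u) *
            ENNReal.ofReal (spreadOutTwoPoint d L β₂ (v - x)) := by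
  have hβ2 : 0 ≤ β₂ := h0.trans h12
  -- it suffices to bound every finite-volume two-point function
  have hlim : Tendsto (fun n => ENNReal.ofReal (boxTwoPoint d L β₂ n x)) atTop
      (𝓝 (ENNReal.ofReal (spreadOutTwoPoint d L β₂ x))) :=
    (ENNReal.continuous_ofReal.tendsto _).comp (tendsto_boxTwoPoint hβ2 x)
  refine le_of_tendsto' hlim fun n => ?_
  by_cases hxn : x ∈ box d n
  swap
  · rw [boxTwoPoint_of_not_mem β₂ hxn, ENNReal.ofReal_zero]; exact zero_le
  -- the finite-volume increment bound, majorised by infinite-volume quantities (reals)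
  set G₂ := spreadOutGraph d L
  have hreal : boxTwoPoint d L β₂ n x ≤ spreadOutTwoPoint d L β₁ x + (β₂ - β₁) *
      ∑ u ∈ box d n, ∑ v ∈ box d n with (spreadOutGraph d L).Adj u v,
        spreadOutTwoPoint d L β₂ u * spreadOutTwoPoint d L β₂ (v - x) := by
    have hinc := isingTwoPoint_free_sub_le (spreadOutGraph d L) h0 h12 (zero_mem_box d n) hxn
    have hmaj : ∑ u ∈ box d n, ∑ v ∈ box d n with (spreadOutGraph d L).Adj u v,
        isingTwoPoint (spreadOutGraph d L) (box d n) β₂ 0 .free 0 u *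
          isingTwoPoint (spreadOutGraph d L) (box d n) β₂ 0 .free x v ≤
        ∑ u ∈ box d n, ∑ v ∈ box d n with (spreadOutGraph d L).Adj u v,
          spreadOutTwoPoint d L β₂ u * spreadOutTwoPoint d L β₂ (v - x) := by
      refine Finset.sum_le_sum fun u hu => Finset.sum_le_sum fun v hv => ?_
      have hv' : v ∈ box d n := (Finset.mem_filter.1 hv).1
      exact mul_le_mul (boxTwoPoint_le_spreadOutTwoPoint β₂ n u)
        (isingTwoPoint_box_le_spreadOutTwoPoint hβ2 hxn hv')
        (isingTwoPoint_free_nonneg _ hβ2 hxn hv') (spreadOutTwoPoint_nonneg hβ2 u)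
    have h1 : boxTwoPoint d L β₁ n x ≤ spreadOutTwoPoint d L β₁ x := boxTwoPoint_le_spreadOutTwoPoint β₁ n x
    have hb2 : boxTwoPoint d L β₂ n x = isingTwoPoint (spreadOutGraph d L) (box d n) β₂ 0 .free 0 x := rfl
    have hb1 : boxTwoPoint d L β₁ n x = isingTwoPoint (spreadOutGraph d L) (box d n) β₁ 0 .free 0 x := rfl
    rw [hb2]
    rw [hb1] at h1
    nlinarith [mul_le_mul_of_nonneg_right hmaj (sub_nonneg.2 h12)]
  -- pass to `[0, ∞]`
  have hnn : ∀ u v : Site d, 0 ≤ spreadOutTwoPoint d L β₂ u * spreadOutTwoPoint d L β₂ (v - x) :=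
    fun u v => mul_nonneg (spreadOutTwoPoint_nonneg hβ2 u) (spreadOutTwoPoint_nonneg hβ2 _)
  calc ENNReal.ofReal (boxTwoPoint d L β₂ n x)
      ≤ ENNReal.ofReal (spreadOutTwoPoint d L β₁ x + (β₂ - β₁) *
          ∑ u ∈ box d n, ∑ v ∈ box d n with (spreadOutGraph d L).Adj u v,
            spreadOutTwoPoint d L β₂ u * spreadOutTwoPoint d L β₂ (v - x)) :=
        ENNReal.ofReal_le_ofReal hreal
    _ = ENNReal.ofReal (spreadOutTwoPoint d L β₁ x) + ENNReal.ofReal (β₂ - β₁) *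
          ∑ u ∈ box d n, ∑ v ∈ box d n with (spreadOutGraph d L).Adj u v,
            ENNReal.ofReal (spreadOutTwoPoint d L β₂ u) *
              ENNReal.ofReal (spreadOutTwoPoint d L β₂ (v - x)) := by
        rw [ENNReal.ofReal_add (spreadOutTwoPoint_nonneg h0 x)
            (mul_nonneg (sub_nonneg.2 h12) (Finset.sum_nonneg fun u _ =>
              Finset.sum_nonneg fun v _ => hnn u v)),
          ENNReal.ofReal_mul (sub_nonneg.2 h12),
          ENNReal.ofReal_sum_of_nonneg (fun u _ => Finset.sum_nonneg fun v _ => hnn u v)]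
        congr 2
        refine Finset.sum_congr rfl fun u _ => ?_
        rw [ENNReal.ofReal_sum_of_nonneg (fun v _ => hnn u v)]
        refine Finset.sum_congr rfl fun v _ => ?_
        rw [ENNReal.ofReal_mul (spreadOutTwoPoint_nonneg hβ2 u)]
    _ ≤ ENNReal.ofReal (spreadOutTwoPoint d L β₁ x) + ENNReal.ofReal (β₂ - β₁) *
          ∑' u : Site d, ∑ v ∈ (spreadOutGraph d L).neighborFinset u,
            ENNReal.ofReal (spreadOutTwoPoint d L β₂ u) *
              ENNReal.ofReal (spreadOutTwoPoint d L β₂ (v - x)) := by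
        gcongr
        refine (Finset.sum_le_sum fun u _ => ?_).trans (ENNReal.sum_le_tsum _)
        refine Finset.sum_le_sum_of_subset fun v hv => ?_
        rw [SimpleGraph.mem_neighborFinset]
        exact (Finset.mem_filter.1 hv).2

/-- `Σ_x G_β(v - x) = χ_β` (reindexing `x ↦ v - x`). [folklore] -/
theorem tsum_ofReal_spreadOutTwoPoint_sub (β : ℝ) (v : Site d) :
    ∑' x : Site d, ENNReal.ofReal (spreadOutTwoPoint d L β (v - x)) = spreadOutSusceptibility d L β := by
  rw [spreadOutSusceptibility]
  exact (Equiv.subLeft v).tsum_eq (fun y => ENNReal.ofReal (spreadOutTwoPoint d L β y))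

/-- **`Σ_x Ψ_β(x) = |J| χ_β²`** (Tonelli; translation invariance of `Σ_x G_β(v - x)`; every site
has `|J|` neighbours). [cite: DuminilCopinICM2022, §7.1 (∂_β χ ≤ 2dχ²)] -/
theorem tsum_derivKernel (β : ℝ) :
    ∑' x : Site d, ∑' u : Site d, ∑ v ∈ (spreadOutGraph d L).neighborFinset u,
        ENNReal.ofReal (spreadOutTwoPoint d L β u) * ENNReal.ofReal (spreadOutTwoPoint d L β (v - x)) =
      ((spreadOutGraph d L).degree 0 : ℝ≥0∞) * spreadOutSusceptibility d L β *
        spreadOutSusceptibility d L β := by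
  rw [ENNReal.tsum_comm]
  have hinner : ∀ u : Site d,
      ∑' x : Site d, ∑ v ∈ (spreadOutGraph d L).neighborFinset u,
        ENNReal.ofReal (spreadOutTwoPoint d L β u) * ENNReal.ofReal (spreadOutTwoPoint d L β (v - x)) =
      ENNReal.ofReal (spreadOutTwoPoint d L β u) *
        (((spreadOutGraph d L).degree 0 : ℝ≥0∞) * spreadOutSusceptibility d L β) := by
    intro u
    rw [Summable.tsum_finsetSum (fun v _ => ENNReal.summable)]
    simp_rw [ENNReal.tsum_mul_left, tsum_ofReal_spreadOutTwoPoint_sub]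
    rw [Finset.sum_const, card_neighborFinset_spreadOutGraph, nsmul_eq_mul]
    ring
  simp_rw [hinner]
  rw [ENNReal.tsum_mul_right, ← spreadOutSusceptibility]
  ring

/-- **The increment bound for `χ`** in `[0, ∞]`: for `0 ≤ β₁ ≤ β₂`,
`χ_{β₂} ≤ χ_{β₁} + (β₂ - β₁)·|J|·χ_{β₂}²` (sum the increment bound for `G_β(x)` over `x`).
[cite: DuminilCopinICM2022, §7.1 (∂_β χ ≤ 2dχ²)] -/
theorem susceptibility_le_add_mul_sq {β₁ β₂ : ℝ} (h0 : 0 ≤ β₁) (h12 : β₁ ≤ β₂) :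
    spreadOutSusceptibility d L β₂ ≤ spreadOutSusceptibility d L β₁ +
      ENNReal.ofReal (β₂ - β₁) * (((spreadOutGraph d L).degree 0 : ℝ≥0∞) *
        spreadOutSusceptibility d L β₂ * spreadOutSusceptibility d L β₂) := by
  rw [← tsum_derivKernel, ← ENNReal.tsum_mul_left, spreadOutSusceptibility, spreadOutSusceptibility,
    ← ENNReal.tsum_add]
  exact ENNReal.tsum_le_tsum fun x => ofReal_spreadOutTwoPoint_le_add h0 h12 x

/-- The increment bound in real form: for `0 ≤ β₁ ≤ β₂` with `χ_{β₂} < ∞`,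
`χ_{β₂} - χ_{β₁} ≤ |J| (β₂ - β₁) χ_{β₂}²`. [cite: DuminilCopinICM2022, §7.1 (∂_β χ ≤ 2dχ²)] -/
theorem toReal_susceptibility_sub_le {β₁ β₂ : ℝ} (h0 : 0 ≤ β₁) (h12 : β₁ ≤ β₂)
    (hfin : spreadOutSusceptibility d L β₂ < ∞) :
    (spreadOutSusceptibility d L β₂).toReal - (spreadOutSusceptibility d L β₁).toReal ≤
      ((spreadOutGraph d L).degree 0 : ℝ) * (β₂ - β₁) * (spreadOutSusceptibility d L β₂).toReal ^ 2 := by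
  have h := susceptibility_le_add_mul_sq (d := d) (L := L) h0 h12
  have hfin1 : spreadOutSusceptibility d L β₁ < ∞ :=
    lt_of_le_of_lt (susceptibility_mono h0 (h0.trans h12) h12) hfin
  have hrhs : spreadOutSusceptibility d L β₁ +
      ENNReal.ofReal (β₂ - β₁) * (((spreadOutGraph d L).degree 0 : ℝ≥0∞) *
        spreadOutSusceptibility d L β₂ * spreadOutSusceptibility d L β₂) ≠ ∞ := by
    refine ENNReal.add_ne_top.2 ⟨hfin1.ne, ENNReal.mul_ne_top ENNReal.ofReal_ne_top ?_⟩
    exact ENNReal.mul_ne_top (ENNReal.mul_ne_top (ENNReal.natCast_ne_top _) hfin.ne) hfin.ne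
  have h' := (ENNReal.toReal_le_toReal hfin.ne hrhs).2 h
  rw [ENNReal.toReal_add hfin1.ne (ENNReal.mul_ne_top ENNReal.ofReal_ne_top
      (ENNReal.mul_ne_top (ENNReal.mul_ne_top (ENNReal.natCast_ne_top _) hfin.ne) hfin.ne)),
    ENNReal.toReal_mul, ENNReal.toReal_mul, ENNReal.toReal_mul, ENNReal.toReal_ofReal (sub_nonneg.2 h12),
    ENNReal.toReal_natCast] at h'
  nlinarith [h']

/-! ### Step D. From the increment bound to the integrated inequality for `χ⁻¹` (discharge of fact 3) -/

/-- **Partition argument.** If `f ≥ 1` is nondecreasing on `[a, b]` and satisfies the one-sided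
increment bound `f(t) - f(s) ≤ D (t - s) f(t)²` for `a ≤ s ≤ t ≤ b` (`D ≥ 0`), then
`f(a)⁻¹ - f(b)⁻¹ ≤ D (b - a)`: over a partition of mesh `δ`, `f(tᵢ)⁻¹ - f(tᵢ₊₁)⁻¹ ≤
Dδ f(tᵢ₊₁)/f(tᵢ) ≤ Dδ (1 + f(tᵢ₊₁) - f(tᵢ))`, which telescopes to `D(b-a) + Dδ(f(b) - f(a))`, and
`δ → 0`. (The elementary passage from `∂_β χ ≤ |J|χ²` to `∂_β χ⁻¹ ≥ -|J|` without
differentiability of the limit `χ`.) [folklore] -/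
theorem inv_sub_inv_le_of_increment {f : ℝ → ℝ} {a b D : ℝ} (hab : a ≤ b) (hD : 0 ≤ D)
    (hf1 : ∀ t ∈ Set.Icc a b, 1 ≤ f t) (hmono : MonotoneOn f (Set.Icc a b))
    (hinc : ∀ s ∈ Set.Icc a b, ∀ t ∈ Set.Icc a b, s ≤ t → f t - f s ≤ D * (t - s) * f t ^ 2) :
    (f a)⁻¹ - (f b)⁻¹ ≤ D * (b - a) := by
  have ha : a ∈ Set.Icc a b := Set.left_mem_Icc.2 hab
  have hb : b ∈ Set.Icc a b := Set.right_mem_Icc.2 hab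
  -- the bound along the uniform partition with `k` steps
  have hpart : ∀ k : ℕ, 0 < k →
      (f a)⁻¹ - (f b)⁻¹ ≤ D * (b - a) + D * (b - a) * (f b - f a) / k := by
    intro k hk
    have hk' : (0 : ℝ) < k := Nat.cast_pos.2 hk
    set δ : ℝ := (b - a) / k with hδ
    have hδ0 : 0 ≤ δ := div_nonneg (sub_nonneg.2 hab) hk'.le
    set t : ℕ → ℝ := fun i => a + i * δ with ht
    have ht0 : t 0 = a := by simp [ht]
    have htk : t k = b := by
      simp only [ht, hδ]; field_simp; ring
    have htmem : ∀ i : ℕ, i ≤ k → t i ∈ Set.Icc a b := by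
      intro i hi
      have hi' : (i : ℝ) ≤ k := Nat.cast_le.2 hi
      refine ⟨by simp only [ht]; nlinarith, ?_⟩
      calc t i = a + i * δ := rfl
        _ ≤ a + k * δ := by nlinarith
        _ = b := by simp only [hδ]; field_simp; ring
    -- one step of the partition
    have hstep : ∀ i : ℕ, i < k →
        (f (t i))⁻¹ - (f (t (i + 1)))⁻¹ ≤ D * δ + D * δ * (f (t (i + 1)) - f (t i)) := by
      intro i hi
      have hi1 : t i ∈ Set.Icc a b := htmem i hi.le
      have hi2 : t (i + 1) ∈ Set.Icc a b := htmem (i + 1) hi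
      have hle : t i ≤ t (i + 1) := by
        simp only [ht, Nat.cast_add, Nat.cast_one]; nlinarith
      set p := f (t i) with hp
      set q := f (t (i + 1)) with hq
      have hp1 : 1 ≤ p := hf1 _ hi1
      have hq1 : 1 ≤ q := hf1 _ hi2
      have hpq : p ≤ q := hmono hi1 hi2 hle
      have hincr : q - p ≤ D * δ * q ^ 2 := by
        have := hinc _ hi1 _ hi2 hle
        have hts : t (i + 1) - t i = δ := by
          simp only [ht, Nat.cast_add, Nat.cast_one]; ring
        rwa [hts] at this
      have hp0 : 0 < p := by linarith
      have hq0 : 0 < q := by linarith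
      have h1 : p⁻¹ - q⁻¹ = (q - p) / (p * q) := by
        field_simp
      have h2 : (q - p) / (p * q) ≤ D * δ * q ^ 2 / (p * q) :=
        div_le_div_of_nonneg_right hincr (by positivity)
      have h3 : D * δ * q ^ 2 / (p * q) = D * δ * (q / p) := by
        field_simp
      have h4 : q / p ≤ 1 + (q - p) := by
        rw [div_le_iff₀ hp0]; nlinarith
      have h5 : D * δ * (q / p) ≤ D * δ * (1 + (q - p)) :=
        mul_le_mul_of_nonneg_left h4 (mul_nonneg hD hδ0)
      calc p⁻¹ - q⁻¹ = (q - p) / (p * q) := h1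
        _ ≤ D * δ * q ^ 2 / (p * q) := h2
        _ = D * δ * (q / p) := h3
        _ ≤ D * δ * (1 + (q - p)) := h5
        _ = D * δ + D * δ * (q - p) := by ring
    -- telescope
    have hsum := Finset.sum_le_sum fun i hi => hstep i (Finset.mem_range.1 hi)
    rw [Finset.sum_range_sub' (fun i => (f (t i))⁻¹) k, Finset.sum_add_distrib, Finset.sum_const,
      Finset.card_range, ← Finset.mul_sum, Finset.sum_range_sub (fun i => f (t i)) k, ht0, htk,
      nsmul_eq_mul] at hsum
    have hkδ : (k : ℝ) * (D * δ) = D * (b - a) := by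
      simp only [hδ]; field_simp
    have hδ' : D * δ * (f b - f a) = D * (b - a) * (f b - f a) / k := by
      simp only [hδ]; field_simp
    linarith
  -- let the mesh go to zero
  refine le_of_forall_pos_lt_add fun ε hε => ?_
  set Cst := D * (b - a) * (f b - f a) with hCst
  have hC0 : 0 ≤ Cst := mul_nonneg (mul_nonneg hD (sub_nonneg.2 hab))
    (sub_nonneg.2 (hmono ha hb hab))
  obtain ⟨k, hk⟩ := exists_nat_gt (Cst / ε)
  have hkpos : 0 < k := by
    rcases Nat.eq_zero_or_pos k with rfl | h
    · simp at hk; exact absurd hk (not_lt.2 (div_nonneg hC0 hε.le))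
    · exact h
  have hk' : (0 : ℝ) < k := Nat.cast_pos.2 hkpos
  have h1 := hpart k hkpos
  have h2 : Cst / k < ε := by
    rw [div_lt_iff₀ hk']
    rw [div_lt_iff₀ hε] at hk
    linarith
  linarith

/-- **Fact 3 discharged: the integrated Lebowitz inequality `χ_{β₁}⁻¹ - χ_{β₂}⁻¹ ≤ |J|(β₂ - β₁)`**
for the uniformly spread-out Ising model, `0 ≤ β₁ ≤ β₂`, `χ_{β₂} < ∞` — the mean-field bound
`γ ≥ 1` in integrated form, from Lebowitz' inequality in finite volume
(`deriv_isingTwoPoint_free_le`), GKS monotonicity and the monotone infinite-volume limit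
(`susceptibility_le_add_mul_sq`), and the partition argument (`inv_sub_inv_le_of_increment`).
[cite: DuminilCopinICM2022, §7.1 (∂_β χ ≤ 2dχ²)] [cite: Sakai2007, §1.1 (γ ≥ 1)]
[cite: GlimmJaffe1987, Thm. 17.7.1 (γ ≥ γ_cl = 1)] -/
theorem inv_susceptibility_sub_le_holds : inv_susceptibility_sub_le := by
  intro d L β₁ β₂ h0 h12 hfin
  set D : ℝ := ((spreadOutGraph d L).degree 0 : ℝ) with hD
  have hD0 : 0 ≤ D := Nat.cast_nonneg _
  have hfin' : ∀ t ∈ Set.Icc β₁ β₂, spreadOutSusceptibility d L t < ∞ := fun t ht =>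
    lt_of_le_of_lt (susceptibility_mono (h0.trans ht.1) (h0.trans h12) ht.2) hfin
  refine inv_sub_inv_le_of_increment (f := fun β => (spreadOutSusceptibility d L β).toReal) h12 hD0
    (fun t ht => one_le_susceptibility_toReal (hfin' t ht)) ?_ ?_
  · intro s hs t ht hst
    exact ENNReal.toReal_mono (hfin' t ht).ne (susceptibility_mono (h0.trans hs.1) (h0.trans ht.1) hst)
  · intro s hs t ht hst
    have := toReal_susceptibility_sub_le (d := d) (L := L) (h0.trans hs.1) hst (hfin' t ht)
    nlinarith [this]

/-- `IsingBubbleMeanField` from facts 1, 2, 4, 5 (fact 3 being proved).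
[cite: Sakai2007, §1.1 (bubble condition ⇒ γ = 1)] -/
theorem IsingBubbleMeanField_of_facts' (h1 : exists_pos_susceptibility_lt_top)
    (h2 : exists_forall_le_susceptibility_eq_top)
    (h4 : susceptibility_unbounded_below_critBeta) (h5 : bubble_susceptibility_upper) :
    IsingBubbleMeanField :=
  IsingBubbleMeanField_of_facts h1 h2 inv_susceptibility_sub_le_holds h4 h5

end Literature.Barriers.CriticalPhenomena.SpreadOutIsing

end
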